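import Summits.Ventures.PercRepro.S1CoreCapSevenFinal
import Summits.Ventures.PercRepro.S1CoreCapEightFourAll

/-!
# PercRepro — THE `s₄` TABLE WITH `Q*(8) ≤ 25`, MODULO THE ONE OPEN CASE (p1, gen 27)

CONDITIONAL on `Eight.ThreeBigNonplanarBound₈` (three big lines not in a plane have cap `≤ 25` — the one case
of the `ν = 8` tree still open; the census value is `Q*(8) = 23`, the census maximum of that case `19`): the
spec instances `j ≤ 8` are then theorems with the table `qEight = 0, 1, 4, 5, 8, 11, 16, 19, 25`
(`fourCapSpec_qEight_le_eight_of`), so on the e-free core of nullity `8` the number of 4-circuits through a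
point is `≤ 25` (`ncard_fourCircuitsThrough_le_twenty_five_of`, from `31 = ⌊3·8/2⌋ + 19`, the star step) and
`s₄ ≤ 64 + 25 = 89` (`ncard_fourCircuits_le_eighty_nine_of`, from `92`); the averaging recursion of
`S1CoreCapAvg` gives `s₄ ≤ avgBoundEight k` at nullity `k + 8`, `avgBoundEight 0 = 89`,
`avgBoundEight (k + 1) = ⌊(k + 14) · avgBoundEight k / (k + 10)⌋`: `89, 124, 169, 225, 294, 378, …`
(from `92, 128, 174, 232, 303, 389`). Everything here takes the open case as an explicit hypothesis `hA`; the
unconditional table of record stays `S1CoreCapSevenFinal`. `proofs/P1-S4-CAPBRIDGE.md` §19.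
Axioms: standard.
-/

open scoped Matroid

namespace PercRepro

namespace S1

open Set

open FourCap

variable {α : Type}

/-- The per-point table with `25` at nullity `8`: `0, 1, 4, 5, 8, 11, 16, 19, 25`. -/
def qEight (j : ℕ) : ℕ := if j = 8 then 25 else qStar j

/-- `Σ_{j ≤ 8} qEight j = 89`. -/
theorem capSum_qEight_eight : capSum qEight 8 = 89 := by decide

/-- The instances `j ≤ 8` of the spec, modulo the open case. -/
theorem fourCapSpec_qEight_le_eight_of (hA : Eight.ThreeBigNonplanarBound₈) :
    ∀ j ≤ 8, FourCapSpec capPaper j (qEight j) := by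
  intro j hj
  rcases (by omega : j ≤ 7 ∨ j = 8) with h | rfl
  · have e : qEight j = qStar j := by
      unfold qEight
      rw [if_neg (by omega)]
    rw [e]
    exact fourCapSpec_qStar_le_seven_unconditional j h
  · exact Eight.fourCapSpec_eight_of_threeBig hA

/-- **At most `25` 4-circuits through any point of an e-free core of nullity `8`**, modulo the open case. -/
theorem ncard_fourCircuitsThrough_le_twenty_five_of (hA : Eight.ThreeBigNonplanarBound₈) (M : Matroid α)
    [M.Finite] (hfree : ∀ e ∈ M.E, ∃ A ⊆ M.E \ {e}, e ∉ M.closure A ∧ e ∉ M.closure ((M.E \ {e}) \ A))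
    (hd : M.E.encard = M.eRank + 8) {e : α} (he : e ∈ M.E) :
    {C : Set α | M.IsCircuit C ∧ C.ncard = 4 ∧ e ∈ C}.ncard ≤ 25 :=
  ncard_fourCircuitsThrough_le_of_fourCapSpec M hfree hd he (Eight.fourCapSpec_eight_of_threeBig hA)

/-- **`s₄ ≤ 89` on every e-free core of nullity `8`**, modulo the open case (from `92`). -/
theorem ncard_fourCircuits_le_eighty_nine_of (hA : Eight.ThreeBigNonplanarBound₈) (M : Matroid α) [M.Finite]
    (hfree : ∀ e ∈ M.E, ∃ A ⊆ M.E \ {e}, e ∉ M.closure A ∧ e ∉ M.closure ((M.E \ {e}) \ A))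
    (hd : M.E.encard = M.eRank + 8) : {C : Set α | M.IsCircuit C ∧ C.ncard = 4}.ncard ≤ 89 := by
  have := ncard_fourCircuits_le_capSum M hfree hd qEight (fourCapSpec_qEight_le_eight_of hA)
  rwa [capSum_qEight_eight] at this

/-- **The averaging table from `89`**: `avgBoundEight k` bounds `s₄` at nullity `k + 8` — `89` at `k = 0`, then
`⌊(k + 14) · avgBoundEight k / (k + 10)⌋`: `89, 124, 169, 225, 294, 378, …`. -/
def avgBoundEight : ℕ → ℕ
  | 0 => 89
  | k + 1 => (k + 14) * avgBoundEight k / (k + 10)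

/-- **`s₄ ≤ avgBoundEight k` on every e-free core of nullity `k + 8`**, modulo the open case. -/
theorem ncard_fourCircuits_le_avgBoundEight_of (hA : Eight.ThreeBigNonplanarBound₈) (k : ℕ) :
    ∀ (M : Matroid α) [M.Finite],
    (∀ e ∈ M.E, ∃ A ⊆ M.E \ {e}, e ∉ M.closure A ∧ e ∉ M.closure ((M.E \ {e}) \ A)) →
    M.E.encard = M.eRank + (k + 8) → {C : Set α | M.IsCircuit C ∧ C.ncard = 4}.ncard ≤ avgBoundEight k := by
  induction k with
  | zero =>
    intro M _ hfree hd
    exact ncard_fourCircuits_le_eighty_nine_of hA M hfree hd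
  | succ k ih =>
    intro M _ hfree hd
    have hd' : M.E.encard = M.eRank + ((k + 8) + 1) := by
      rw [hd]; congr 1
    have h := ncard_fourCircuits_sub_div_le M hfree (d := k + 8) hd' (by omega)
      (fun M' _ hfree' hd'' => ih M' hfree' hd'')
    have h' := le_mul_div_of_sub_div_le (m := k + 8 + 6) (by omega) h
    simp only [avgBoundEight]
    have e1 : k + 8 + 6 = k + 14 := by omega
    have e2 : k + 8 + 6 - 4 = k + 10 := by omega
    rw [e1, e2] at h'
    exact h'

/-- The first values of the table from `89`. -/
theorem avgBoundEight_values : avgBoundEight 1 = 124 ∧ avgBoundEight 2 = 169 ∧ avgBoundEight 3 = 225 ∧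
    avgBoundEight 4 = 294 ∧ avgBoundEight 5 = 378 := by decide

/-- **`s₄ ≤ 124` on every e-free core of nullity `9`**, modulo the open case (from `128`). -/
theorem ncard_fourCircuits_le_one_hundred_twenty_four_of (hA : Eight.ThreeBigNonplanarBound₈) (M : Matroid α)
    [M.Finite] (hfree : ∀ e ∈ M.E, ∃ A ⊆ M.E \ {e}, e ∉ M.closure A ∧ e ∉ M.closure ((M.E \ {e}) \ A))
    (hd : M.E.encard = M.eRank + 9) : {C : Set α | M.IsCircuit C ∧ C.ncard = 4}.ncard ≤ 124 := by
  have := ncard_fourCircuits_le_avgBoundEight_of hA 1 M hfree hd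
  rwa [avgBoundEight_values.1] at this

end S1

end PercRepro
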